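import Mathlib
import Summits.Ventures.PercRepro2.Defs
import Summits.Ventures.PercRepro2.Graph
import Summits.Ventures.PercRepro2.Induced
import Summits.Ventures.PercRepro2.VdBKahn
import Summits.Ventures.PercRepro2.ReimerVdBK
import Summits.Ventures.PercRepro2.ReimerVdBKRegions
import Summits.Ventures.PercRepro2.ReimerVdBKFlip
import Summits.Ventures.PercRepro2.ReimerVdBKTrivialCore
import Summits.Ventures.PercRepro2.ReimerVdBKZClosed
import Summits.Ventures.PercRepro2.ReimerVdBKZReduction
import Summits.Ventures.PercRepro2.ReimerVdBKZSplit
import Summits.Ventures.PercRepro2.ReimerVdBKZRecursion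
import Summits.Ventures.PercRepro2.ReimerVdBKTypeWeight
import Summits.Ventures.PercRepro2.ReimerVdBKPairType
import Summits.Ventures.PercRepro2.ReimerVdBKCoreDown

/-!
# The shadow rule: a vertex separated from the root by the avoided set is never in the core on the right
(blind cell PercRepro2, mine-c g47; `conjectures/MINE-C.md` §56.7 (c))

If every path of the underlying graph from `s` to `v` meets `S` (`¬ GConn Sᶜ s v`), then in every colouring whose
world 2 avoids `S`, `v ∉ K₂` (`not_mem_K₂_of_shadow`).  On the right side of (CORE↓) world 2 avoids `X ∪ Y`, so
such a `v` is never in the core there and the core-avoidance weight at `v` costs nothing on the right while it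
can only lower the left: **(CORE↓) at `N` gives (CORE↓) at `insert v N`** (`coreDown_insert_of_shadow`) — the
SHADOW RULE of the type-weight calculus (an `F₀`-vertex shadowed by `X ∪ Y` may be retyped `U`); reach
+0.58 % at `n = 5` (`MINE-C.md` §56.7 (c)).
-/

namespace Summit.Ventures.PercRepro2
namespace ReimerVdBK
open Classical

variable {V : Type*} {E : Type*} [Fintype E] [DecidableEq E] [Fintype V] [DecidableEq V]
variable (ends : E → Sym2 V) (s : V)

omit [Fintype E] [DecidableEq E] [Fintype V] [DecidableEq V] in
/-- **Shadowed vertices are not reached by an avoiding world**: if `s` and `v` are not joined inside `Sᶜ`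
and the cluster of `s` in `ω` avoids `S`, then `v` is not in that cluster. -/
theorem not_conn_of_shadow {S : Set V} {v : V} (hsh : ¬ GConn ends Sᶜ s v) (ω : Config E)
    (havoid : ∀ x ∈ S, ¬ Conn ends ω s x) : ¬ Conn ends ω s v := by
  intro hv
  let T : Set V := {x | Conn ends ω s x → GConn ends Sᶜ s x}
  have hT : ∀ x ∈ T, ∀ y, (openGraph ends ω).Adj x y → y ∈ T := by
    intro x hx y hxy hy
    obtain ⟨_, e, he, hends⟩ := openGraph_adj.1 hxy
    have hx' : Conn ends ω s x :=
      conn_trans hy (conn_of_openAdj ⟨e, he, by rw [hends, Sym2.eq_swap]⟩)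
    have hxS : x ∉ S := fun hxS => havoid x hxS hx'
    have hyS : y ∉ S := fun hyS => havoid y hyS hy
    exact gconn_trans ends (hx hx') (gconn_of_edge ends hends hxS hyS)
  have hs : s ∈ T := fun _ => gconn_refl ends s
  exact hsh (mem_of_conn_of_closed hT hs hv hv)

omit [Fintype E] [DecidableEq E] [Fintype V] in
/-- On the right side of (R-1.2) a vertex shadowed by `X ∪ Y` is never in `K₂`. -/
theorem not_mem_K₂_of_shadow {X Y : Finset V} {v : V} (hsh : ¬ GConn ends ((X ∪ Y : Finset V) : Set V)ᶜ s v)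
    {A : Finset V} {ω : Config E} (hω : ω ∈ twoWorld ends s A ∅ ∅ (X ∪ Y)) :
    ¬ Conn ends (compl ω) s v := by
  rw [mem_twoWorld_iff] at hω
  obtain ⟨_, _, _, hY⟩ := hω
  exact not_conn_of_shadow ends s hsh (compl ω) fun x hx => hY x (Finset.mem_coe.1 hx)

/-- The core-restricted right count does not see a shadowed vertex. -/
theorem coreCount_right_insert_of_shadow (A X B Y N : Finset V) {v : V}
    (hsh : ¬ GConn ends ((X ∪ Y : Finset V) : Set V)ᶜ s v) :
    coreCount ends s (A ∪ B) ∅ ∅ (X ∪ Y) (insert v N) = coreCount ends s (A ∪ B) ∅ ∅ (X ∪ Y) N := by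
  unfold coreCount
  rw [pcount_coreW_eq_count, pcount_coreW_eq_count]
  congr 1
  ext ω
  simp only [Set.mem_inter_iff, Set.mem_setOf_eq, Finset.mem_insert, forall_eq_or_imp]
  constructor
  · rintro ⟨hω, _, hN⟩
    exact ⟨hω, hN⟩
  · rintro ⟨hω, hN⟩
    refine ⟨hω, fun h => not_mem_K₂_of_shadow ends s hsh hω h.2, hN⟩

/-- The core-restricted left count can only decrease when a vertex is added. -/
theorem coreCount_insert_le (A X B Y N : Finset V) (v : V) :
    coreCount ends s A X B Y (insert v N) ≤ coreCount ends s A X B Y N := by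
  unfold coreCount
  rw [pcount_coreW_eq_count, pcount_coreW_eq_count]
  apply count_mono
  intro ω hω
  simp only [Set.mem_inter_iff, Set.mem_setOf_eq, Finset.mem_insert, forall_eq_or_imp] at hω ⊢
  exact ⟨hω.1, hω.2.2⟩

/-- **The shadow rule**: (CORE↓) at `N` gives (CORE↓) at `insert v N` whenever every path of the underlying
graph from `s` to `v` meets `X ∪ Y`. -/
theorem coreDown_insert_of_shadow (A X B Y N : Finset V) {v : V}
    (hsh : ¬ GConn ends ((X ∪ Y : Finset V) : Set V)ᶜ s v) (h : CoreDown ends s A X B Y N) :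
    CoreDown ends s A X B Y (insert v N) := by
  unfold CoreDown at h ⊢
  rw [coreCount_right_insert_of_shadow ends s A X B Y N hsh]
  exact (coreCount_insert_le ends s A X B Y N v).trans h

end ReimerVdBK
end Summit.Ventures.PercRepro2
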